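import Summits.KontsevichZagierPeriods.KontsevichZagierPeriods.Theorems.FermatIsogenyDeepWordSectorP09
/-! # `FermatIsogenyDeepWordSectorP10` — part 10/11 of the mechanical ≤400-line split of `DeepWordSector.lean` (sha256 5e8cd5c1c920648a…)
Source: decomp-kz lens-5 g22 DeepWordSector.lean v10 @5e8cd5c1 (the deep Beta-word sector node: bridge S ⟺ BetaWordTower ∧ WordSectorComplete, finite boxes, box ladder, shadow arithmetic, Chudnovsky levels; critic CLEARED g6-2/3/4/11/13/16/19); --supports stmt-KontsevichZagierPeriods-3898.
Split by census-1 g10 `gen/splitlean.py`: scopes re-opened with their `open`/`variable`/`set_option` context; mathematics and declaration order unchanged. -/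

namespace Summit.KontsevichZagierPeriods.FermatIsogeny.DeepTargets
open Literature.NumberTheory.Transcendental MeasureTheory
open Summit.KontsevichZagierPeriods.KontsevichZagierPeriods.Theses.FermatIsogeny (BetaLinearSector BetaProductSector FermatSectorComplete)
open Literature.NumberTheory.Transcendental MeasureTheory in
open Summit.KontsevichZagierPeriods.KontsevichZagierPeriods.Theses.FermatIsogeny (BetaLinearSector BetaProductSector FermatSectorComplete) in
/-- Integer powers of an algebraic real are algebraic. [folklore] -/
private theorem isAlgebraic_zpow {x : ℝ} (hx : IsAlgebraic ℚ x) (m : ℤ) : IsAlgebraic ℚ (x ^ m) := by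
  cases m with
  | ofNat k => rw [Int.ofNat_eq_natCast, zpow_natCast]; exact hx.pow k
  | negSucc k => rw [zpow_negSucc]; exact (hx.pow _).inv

open Literature.NumberTheory.Transcendental MeasureTheory in
open Summit.KontsevichZagierPeriods.KontsevichZagierPeriods.Theses.FermatIsogeny (BetaLinearSector BetaProductSector FermatSectorComplete) in
/-- Rational numbers are real algebraic. [bookkeeping] -/
private theorem isAlgebraic_ratCast (x : ℚ) : IsAlgebraic ℚ (x : ℝ) := by
  have h := isAlgebraic_algebraMap (R := ℚ) (A := ℝ) x
  rwa [eq_ratCast] at h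

section ChudnovskyLevels

/-- Auxiliary step `sum_Ico_one_three`: sum Ico one three. [bookkeeping] -/
theorem sum_Ico_one_three (f : ℕ → ℚ) : ∑ m ∈ Finset.Ico 1 3, f m = f 1 + f 2 := by
  rw [Finset.sum_Ico_eq_sum_range]; simp [Finset.sum_range_succ]

/-- Auxiliary step `prod_Ico_one_four`: prod Ico one four. [bookkeeping] -/
theorem prod_Ico_one_four (f : ℕ → ℝ) : ∏ m ∈ Finset.Ico 1 4, f m = f 1 * f 2 * f 3 := by
  rw [Finset.prod_Ico_eq_prod_range]; simp [Finset.prod_range_succ, mul_assoc]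

/-- Auxiliary step `sum_Ico_one_four`: sum Ico one four. [bookkeeping] -/
theorem sum_Ico_one_four (f : ℕ → ℚ) : ∑ m ∈ Finset.Ico 1 4, f m = f 1 + f 2 + f 3 := by
  rw [Finset.sum_Ico_eq_sum_range]; simp [Finset.sum_range_succ, add_assoc]

/-- Auxiliary step `prod_Ico_one_six`: prod Ico one six. [bookkeeping] -/
theorem prod_Ico_one_six (f : ℕ → ℝ) : ∏ m ∈ Finset.Ico 1 6, f m = f 1 * f 2 * f 3 * f 4 * f 5 := by
  rw [Finset.prod_Ico_eq_prod_range]; simp [Finset.prod_range_succ, mul_assoc]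

/-- Auxiliary step `sum_Ico_one_six`: sum Ico one six. [bookkeeping] -/
theorem sum_Ico_one_six (f : ℕ → ℚ) : ∑ m ∈ Finset.Ico 1 6, f m = f 1 + f 2 + f 3 + f 4 + f 5 := by
  rw [Finset.sum_Ico_eq_sum_range]; simp [Finset.sum_range_succ, add_assoc]

/-- Auxiliary step `sum_Ico_one_six_int`: sum Ico one six int. [bookkeeping] -/
theorem sum_Ico_one_six_int (f : ℕ → ℤ) : ∑ m ∈ Finset.Ico 1 6, f m = f 1 + f 2 + f 3 + f 4 + f 5 := by
  rw [Finset.sum_Ico_eq_sum_range]; simp [Finset.sum_range_succ, add_assoc]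

/-- `Π_i (c_i·x^{a_i}·y^{b_i})^{n_i} = (Π_i c_i^{n_i})·x^{Σ a_i n_i}·y^{Σ b_i n_i}` (`x, y ≠ 0`). [folklore] -/
theorem prod_mul_zpow_zpow {ι : Type*} (s : Finset ι) (c : ι → ℝ) (a b n : ι → ℤ) {x y : ℝ}
    (hx : x ≠ 0) (hy : y ≠ 0) :
    ∏ i ∈ s, (c i * x ^ a i * y ^ b i) ^ n i
      = (∏ i ∈ s, c i ^ n i) * x ^ (∑ i ∈ s, a i * n i) * y ^ (∑ i ∈ s, b i * n i) := by
  classical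
  refine Finset.induction_on s (by simp) ?_
  intro j s hj ih
  rw [Finset.prod_insert hj, Finset.prod_insert hj, Finset.sum_insert hj, Finset.sum_insert hj, ih,
    zpow_add₀ hx, zpow_add₀ hy, mul_zpow, mul_zpow, ← zpow_mul, ← zpow_mul]
  ring

/-- Reflection at `⅓`: `Γ(⅔) = (2π/√3)·Γ(⅓)⁻¹`. [folklore] -/
theorem Gamma_two_thirds :
    Real.Gamma ((2:ℝ)/3) = 2 * Real.pi / Real.sqrt 3 * (Real.Gamma ((1:ℝ)/3))⁻¹ := by
  have h := Real.Gamma_mul_Gamma_one_sub ((1:ℝ)/3)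
  rw [show (1:ℝ) - 1/3 = 2/3 by norm_num, show Real.pi * (1/3) = Real.pi / 3 by ring,
    Real.sin_pi_div_three] at h
  have hG : Real.Gamma ((1:ℝ)/3) ≠ 0 := (Real.Gamma_pos_of_pos (by norm_num)).ne'
  have h3 : Real.sqrt 3 ≠ 0 := by positivity
  field_simp
  field_simp at h
  linear_combination h

/-- Reflection at `¼`: `Γ(¾) = √2·π·Γ(¼)⁻¹`. [folklore] -/
theorem Gamma_three_quarters :
    Real.Gamma ((3:ℝ)/4) = Real.sqrt 2 * Real.pi * (Real.Gamma ((1:ℝ)/4))⁻¹ := by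
  have h := Real.Gamma_mul_Gamma_one_sub ((1:ℝ)/4)
  rw [show (1:ℝ) - 1/4 = 3/4 by norm_num, show Real.pi * (1/4) = Real.pi / 4 by ring,
    Real.sin_pi_div_four] at h
  have hG : Real.Gamma ((1:ℝ)/4) ≠ 0 := (Real.Gamma_pos_of_pos (by norm_num)).ne'
  have h2 : Real.sqrt 2 ≠ 0 := by positivity
  have h22 : Real.sqrt 2 * Real.sqrt 2 = 2 := Real.mul_self_sqrt (by norm_num)
  have h' : Real.Gamma ((1:ℝ)/4) * Real.Gamma ((3:ℝ)/4) = Real.sqrt 2 * Real.pi := by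
    rw [h, div_div_eq_mul_div, div_eq_iff h2]
    linear_combination (-Real.pi) * h22
  rw [eq_mul_inv_iff_mul_eq₀ hG]
  linear_combination h'

/-- Reflection at `⅙`: `Γ(⅙)·Γ(⅚) = 2π`. [folklore] -/
theorem Gamma_one_sixth_mul_Gamma_five_sixths :
    Real.Gamma ((1:ℝ)/6) * Real.Gamma ((5:ℝ)/6) = 2 * Real.pi := by
  have h := Real.Gamma_mul_Gamma_one_sub ((1:ℝ)/6)
  rw [show (1:ℝ) - 1/6 = 5/6 by norm_num, show Real.pi * (1/6) = Real.pi / 6 by ring,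
    Real.sin_pi_div_six] at h
  rw [h]; field_simp

/-- Legendre duplication at `⅙`: `Γ(⅙) = (2^{2/3}·√3/2)·Γ(⅓)²·(√π)⁻¹`. [folklore] -/
theorem Gamma_one_sixth :
    Real.Gamma ((1:ℝ)/6) = (2:ℝ) ^ ((2:ℝ)/3) * Real.sqrt 3 / 2 * Real.Gamma ((1:ℝ)/3) ^ (2:ℤ)
      * (Real.sqrt Real.pi)⁻¹ := by
  have hd := Real.Gamma_mul_Gamma_add_half ((1:ℝ)/6)
  rw [show (1:ℝ)/6 + 1/2 = 2/3 by norm_num, show (2:ℝ) * (1/6) = 1/3 by norm_num,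
    show (1:ℝ) - 1/3 = 2/3 by norm_num, Gamma_two_thirds] at hd
  have hG : Real.Gamma ((1:ℝ)/3) ≠ 0 := (Real.Gamma_pos_of_pos (by norm_num)).ne'
  have h3 : Real.sqrt 3 ≠ 0 := by positivity
  have hπ : Real.pi ≠ 0 := Real.pi_ne_zero
  have hsπ : Real.sqrt Real.pi ≠ 0 := by positivity
  have ht : (2:ℝ) ^ ((2:ℝ)/3) ≠ 0 := by positivity
  have hden : 2 * Real.pi / Real.sqrt 3 * (Real.Gamma ((1:ℝ)/3))⁻¹ ≠ 0 := by positivity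
  have e := eq_div_of_mul_eq hden hd
  rw [e, zpow_two, div_eq_iff hden,
    show (2:ℝ) * Real.pi = 2 * (Real.sqrt Real.pi * Real.sqrt Real.pi) by
      rw [Real.mul_self_sqrt Real.pi_pos.le]]
  field_simp

/-- NAMED HYPOTHESIS — multiplicative independence of `Γ(⅓)` and `π` modulo `ℚ̄ˣ`: `Γ(⅓)^a·π^b ∉ ℚ̄` unless
`a = b = 0`.  A consequence of Chudnovsky's theorem «`Γ(⅓)` and `π` are algebraically independent» (1976)
(cite Waldschmidt 2006, Theorem 14); typed as a hypothesis `(h : GammaThirdPiIndep)`, never as a fact. -/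
def GammaThirdPiIndep : Prop :=
  ∀ a b : ℤ, (a ≠ 0 ∨ b ≠ 0) → Transcendental ℚ (Real.Gamma ((1:ℝ)/3) ^ a * Real.pi ^ b)

/-- NAMED HYPOTHESIS — multiplicative independence of `Γ(¼)` and `π` modulo `ℚ̄ˣ` (⟸ Chudnovsky 1976: `Γ(¼)` and `π`
are algebraically independent) (cite Waldschmidt 2006, Theorem 14); a hypothesis, never a fact. -/
def GammaQuarterPiIndep : Prop :=
  ∀ a b : ℤ, (a ≠ 0 ∨ b ≠ 0) → Transcendental ℚ (Real.Gamma ((1:ℝ)/4) ^ a * Real.pi ^ b)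

/-- **Rohrlich's conjecture at level `N`, Hodge-type form**: an algebraic Γ-monomial on `Γ(m/N)` has DKO type ≡ 0.
(`RohrlichHodge ↔ ∀ N > 1, RohrlichHodgeAt N`.) OPEN for `φ(N) ≥ 4`; a hypothesis, never a fact. [conjecture slice] -/
def RohrlichHodgeAt (N : ℕ) : Prop :=
  ∀ n : ℕ → ℤ, IsAlgebraic ℚ (∏ m ∈ Finset.Ico 1 N, Real.Gamma ((m : ℝ) / N) ^ n m) →
    IsHodgeTypeGammaMonomial N n 0

/-- Auxiliary step `rohrlichHodge_iff_forall`: rohrlich Hodge iff forall. [bookkeeping] -/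
theorem rohrlichHodge_iff_forall : RohrlichHodge ↔ ∀ N, 1 < N → RohrlichHodgeAt N :=
  ⟨fun h N hN n => h N n hN, fun h N n hN => h N hN n⟩

/-- `RohrlichHodgeAt N` gives the same-type shadow of every box at level `N`. [this node] -/
theorem boxTranscendence_sameType_of_rohrlichHodgeAt {N : ℕ} (hN : 0 < N) (hR : RohrlichHodgeAt N) (k : ℕ) :
    BoxTranscendence k N (SameType N) := by
  intro u v u' v' hns halg
  apply hns
  obtain ⟨ρ, hρ, e⟩ := ratio_eq_rat_mul_monomial hN u v u' v'
  have hρ0 : (ρ : ℝ) ≠ 0 := by exact_mod_cast hρ.ne'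
  refine hR _ ?_
  have h2 := (isAlgebraic_ratCast ρ⁻¹).mul halg
  rw [e, ← mul_assoc] at h2
  simpa [hρ0] using h2

/-- Under `RohrlichHodgeAt N` the level-`N` box of every `k`-letter sector is its same-type chains. [this node] -/
theorem betaWordSectorLevel_iff_of_rohrlichHodgeAt {N : ℕ} (hN : 0 < N) (hR : RohrlichHodgeAt N) (k : ℕ) :
    BetaWordSectorLevel k N ↔ BoxChain k N (SameType N) :=
  box_iff_boxChain hN (boxTranscendence_sameType_of_rohrlichHodgeAt hN hR k)

/-- `π^a ∈ ℚ̄ ⇒ a = 0` (Lindemann). [folklore] -/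
theorem zpow_pi_algebraic_imp_zero {a : ℤ} (h : IsAlgebraic ℚ (Real.pi ^ a)) : a = 0 := by
  by_contra ha
  rcases Int.natAbs_eq a with e | e
  · rw [e, zpow_natCast] at h
    exact transcendental_pi_holds (IsAlgebraic.of_pow (Int.natAbs_pos.mpr ha) h)
  · rw [e, zpow_neg, zpow_natCast] at h
    exact transcendental_pi_holds (IsAlgebraic.of_pow (Int.natAbs_pos.mpr ha) (by simpa using h.inv))

/-- From `Γ₀^A·(√π)^B ∈ ℚ̄` and the multiplicative independence of `Γ₀, π`: `A = 0 ∧ B = 0`. [bookkeeping] -/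
theorem exps_zero_of_indep {G : ℝ} (hG : G ≠ 0)
    (hind : ∀ a b : ℤ, (a ≠ 0 ∨ b ≠ 0) → Transcendental ℚ (G ^ a * Real.pi ^ b))
    {A B : ℤ} (hX : IsAlgebraic ℚ (G ^ A * Real.sqrt Real.pi ^ B)) : A = 0 ∧ B = 0 := by
  by_contra hz
  have hπ : Real.pi ≠ 0 := Real.pi_ne_zero
  have hb : Real.pi ^ B = Real.sqrt Real.pi ^ B * Real.sqrt Real.pi ^ B := by
    rw [← mul_zpow, Real.mul_self_sqrt Real.pi_pos.le]
  have hX2 : (G ^ A * Real.sqrt Real.pi ^ B) * (G ^ A * Real.sqrt Real.pi ^ B)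
      = G ^ (2 * A) * Real.pi ^ B := by
    rw [two_mul, zpow_add₀ hG, hb]; ring
  exact hind _ _ (by omega) (hX2 ▸ hX.mul hX)

/-- **Level 2, PROVED**: `RohrlichHodgeAt 2` (the monomial is `Γ(½)^{n₁} = (√π)^{n₁}`; Lindemann). [this node] -/
theorem rohrlichHodgeAt_two : RohrlichHodgeAt 2 := by
  intro n halg
  rw [prod_Ico_one_two] at halg
  simp only [Nat.cast_one, Nat.cast_ofNat, Real.Gamma_one_half_eq] at halg
  have hz : n 1 = 0 := by
    apply zpow_pi_algebraic_imp_zero (a := n 1)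
    have h2 := halg.mul halg
    rwa [← mul_zpow, Real.mul_self_sqrt Real.pi_pos.le] at h2
  intro w _
  rw [sum_Ico_one_two, hz]
  simp

/-- **Level 3 modulo Chudnovsky**: `GammaThirdPiIndep → RohrlichHodgeAt 3`. [this node] -/
theorem rohrlichHodgeAt_three_of (h : GammaThirdPiIndep) : RohrlichHodgeAt 3 := by
  intro n halg
  rw [prod_Ico_one_three] at halg
  simp only [Nat.cast_one, Nat.cast_ofNat] at halg
  have hG : Real.Gamma ((1:ℝ)/3) ≠ 0 := (Real.Gamma_pos_of_pos (by norm_num)).ne'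
  have h3 : Real.sqrt 3 ≠ 0 := by positivity
  have hπ : Real.pi ≠ 0 := Real.pi_ne_zero
  have hsπ : Real.sqrt Real.pi ≠ 0 := by positivity
  have hss : Real.pi = Real.sqrt Real.pi ^ (2:ℤ) := by
    rw [zpow_two, Real.mul_self_sqrt Real.pi_pos.le]
  -- Γ(⅓)^{n₁}·Γ(⅔)^{n₂} = (2/√3)^{n₂} · Γ(⅓)^{n₁-n₂} · (√π)^{2 n₂}
  have key : Real.Gamma ((1:ℝ)/3) ^ n 1 * Real.Gamma ((2:ℝ)/3) ^ n 2
      = (2 / Real.sqrt 3) ^ n 2 * (Real.Gamma ((1:ℝ)/3) ^ (n 1 - n 2) * Real.sqrt Real.pi ^ (2 * n 2)) := by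
    rw [Gamma_two_thirds, zpow_sub₀ hG, zpow_mul, ← hss]
    simp only [mul_zpow, div_zpow, inv_zpow]
    field_simp
  have hc : IsAlgebraic ℚ ((2 / Real.sqrt 3) ^ n 2) :=
    isAlgebraic_zpow (((by simpa using isAlgebraic_nat (R := ℚ) (A := ℝ) 2 : IsAlgebraic ℚ (2:ℝ))).mul
      (isAlgebraic_sqrt_nat 3).inv) _
  have hc0 : (2 / Real.sqrt 3) ^ n 2 ≠ 0 := zpow_ne_zero _ (by positivity)
  have hX : IsAlgebraic ℚ (Real.Gamma ((1:ℝ)/3) ^ (n 1 - n 2) * Real.sqrt Real.pi ^ (2 * n 2)) := by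
    have h2 := hc.inv.mul halg
    rwa [key, ← mul_assoc, inv_mul_cancel₀ hc0, one_mul] at h2
  have hz := exps_zero_of_indep hG h hX
  have hz' : n 1 = 0 ∧ n 2 = 0 := by omega
  intro w _
  rw [sum_Ico_one_three, hz'.1, hz'.2]
  simp

/-- **Level 4 modulo Chudnovsky**: `GammaQuarterPiIndep → RohrlichHodgeAt 4`. [this node] -/
theorem rohrlichHodgeAt_four_of (h : GammaQuarterPiIndep) : RohrlichHodgeAt 4 := by
  intro n halg
  rw [prod_Ico_one_four] at halg
  simp only [Nat.cast_one, Nat.cast_ofNat] at halg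
  rw [show ((2:ℝ) / 4) = 1 / 2 by norm_num, Real.Gamma_one_half_eq] at halg
  have hG : Real.Gamma ((1:ℝ)/4) ≠ 0 := (Real.Gamma_pos_of_pos (by norm_num)).ne'
  have h2 : Real.sqrt 2 ≠ 0 := by positivity
  have hπ : Real.pi ≠ 0 := Real.pi_ne_zero
  have hsπ : Real.sqrt Real.pi ≠ 0 := by positivity
  have hss : Real.pi = Real.sqrt Real.pi ^ (2:ℤ) := by
    rw [zpow_two, Real.mul_self_sqrt Real.pi_pos.le]
  -- Γ(¼)^{n₁}·(√π)^{n₂}·Γ(¾)^{n₃} = (√2)^{n₃} · Γ(¼)^{n₁-n₃} · (√π)^{n₂ + 2 n₃}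
  have key : Real.Gamma ((1:ℝ)/4) ^ n 1 * Real.sqrt Real.pi ^ n 2 * Real.Gamma ((3:ℝ)/4) ^ n 3
      = Real.sqrt 2 ^ n 3 * (Real.Gamma ((1:ℝ)/4) ^ (n 1 - n 3) * Real.sqrt Real.pi ^ (n 2 + 2 * n 3)) := by
    rw [Gamma_three_quarters, zpow_sub₀ hG, zpow_add₀ hsπ, zpow_mul, ← hss]
    simp only [mul_zpow, inv_zpow]
    field_simp
  have hc : IsAlgebraic ℚ (Real.sqrt 2 ^ n 3) := isAlgebraic_zpow (isAlgebraic_sqrt_nat 2) _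
  have hc0 : Real.sqrt 2 ^ n 3 ≠ 0 := zpow_ne_zero _ h2
  have hX : IsAlgebraic ℚ (Real.Gamma ((1:ℝ)/4) ^ (n 1 - n 3) * Real.sqrt Real.pi ^ (n 2 + 2 * n 3)) := by
    have h3 := hc.inv.mul halg
    rwa [key, ← mul_assoc, inv_mul_cancel₀ hc0, one_mul] at h3
  have hz := exps_zero_of_indep hG h hX
  intro w hw
  have hf : ∀ i : ℕ, Int.fract ((w : ℚ) * (i : ℚ) / ((4 : ℕ) : ℚ)) =
      (((w * i) % 4 : ℕ) : ℚ) / ((4 : ℕ) : ℚ) := by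
    intro i
    rw [show (w : ℚ) * (i : ℚ) / ((4 : ℕ) : ℚ) = ((w * i : ℕ) : ℚ) / ((4 : ℕ) : ℚ) by push_cast; ring]
    exact Int.fract_div_natCast_eq_div_natCast_mod
  rw [sum_Ico_one_four, hf 1, hf 2, hf 3]
  have q1 : ((n 1 - n 3 : ℤ) : ℚ) = 0 := by rw [hz.1]; simp
  have q2 : ((n 2 + 2 * n 3 : ℤ) : ℚ) = 0 := by rw [hz.2]; simp
  push_cast at q1 q2
  have hw' : w % 4 = 1 ∨ w % 4 = 3 := by
    have h2 : ¬ 2 ∣ w := fun hd => absurd (Nat.Coprime.coprime_dvd_left hd hw) (by decide)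
    omega
  rcases hw' with h1 | h3
  · have a1 : (w * 1) % 4 = 1 := by omega
    have a2 : (w * 2) % 4 = 2 := by omega
    have a3 : (w * 3) % 4 = 3 := by omega
    rw [a1, a2, a3]; push_cast
    linear_combination (q1 + 2 * q2) / 4
  · have a1 : (w * 1) % 4 = 3 := by omega
    have a2 : (w * 2) % 4 = 2 := by omega
    have a3 : (w * 3) % 4 = 1 := by omega
    rw [a1, a2, a3]; push_cast
    linear_combination (3 * q1 + 2 * q2) / 4

/-- **Level 6 modulo Chudnovsky**: `GammaThirdPiIndep → RohrlichHodgeAt 6` (generators `Γ(⅙) … Γ(⅚)` reduce to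
`Γ(⅓), √π` by reflection, `Γ(½) = √π` and duplication at `⅙`). [this node] -/
theorem rohrlichHodgeAt_six_of (h : GammaThirdPiIndep) : RohrlichHodgeAt 6 := by
  intro n halg
  set t : ℝ := (2:ℝ) ^ ((2:ℝ)/3) * Real.sqrt 3 / 2 with ht
  have hG : Real.Gamma ((1:ℝ)/3) ≠ 0 := (Real.Gamma_pos_of_pos (by norm_num)).ne'
  have hG6 : Real.Gamma ((1:ℝ)/6) ≠ 0 := (Real.Gamma_pos_of_pos (by norm_num)).ne'
  have h3 : Real.sqrt 3 ≠ 0 := by positivity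
  have hπ : Real.pi ≠ 0 := Real.pi_ne_zero
  have hsπ : Real.sqrt Real.pi ≠ 0 := by positivity
  have ht0 : t ≠ 0 := by positivity
  have hss : Real.pi = Real.sqrt Real.pi ^ (2:ℤ) := by
    rw [zpow_two, Real.mul_self_sqrt Real.pi_pos.le]
  -- generator table: Γ(m/6) = c m · Γ(⅓)^{a m} · (√π)^{b m}
  let c : ℕ → ℝ := fun m => if m = 1 then t else if m = 4 then 2 / Real.sqrt 3 else if m = 5 then 2 / t else 1
  let a : ℕ → ℤ := fun m => if m = 1 then 2 else if m = 2 then 1 else if m = 4 then -1 else if m = 5 then -2 else 0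
  let b : ℕ → ℤ := fun m => if m = 1 then -1 else if m = 3 then 1 else if m = 4 then 2 else if m = 5 then 3 else 0
  have g1 : Real.Gamma ((1:ℝ)/6) = t * Real.Gamma ((1:ℝ)/3) ^ (2:ℤ) * Real.sqrt Real.pi ^ (-1:ℤ) := by
    rw [Gamma_one_sixth, ht, zpow_neg, zpow_one]
  have g5 : Real.Gamma ((5:ℝ)/6) = 2 / t * Real.Gamma ((1:ℝ)/3) ^ (-2:ℤ) * Real.sqrt Real.pi ^ (3:ℤ) := by
    have e := Gamma_one_sixth_mul_Gamma_five_sixths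
    rw [g1] at e
    have hden : t * Real.Gamma ((1:ℝ)/3) ^ (2:ℤ) * Real.sqrt Real.pi ^ (-1:ℤ) ≠ 0 := by
      rw [← g1]; exact hG6
    have e' : Real.Gamma ((5:ℝ)/6) * (t * Real.Gamma ((1:ℝ)/3) ^ (2:ℤ) * Real.sqrt Real.pi ^ (-1:ℤ))
        = 2 * Real.pi := by rw [mul_comm]; exact e
    rw [eq_div_of_mul_eq hden e', zpow_neg, zpow_neg, zpow_one,
      show (3:ℤ) = 2 + 1 from rfl, zpow_add₀ hsπ, zpow_one, zpow_two, zpow_two,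
      show (2:ℝ) * Real.pi = 2 * (Real.sqrt Real.pi * Real.sqrt Real.pi) by
        rw [Real.mul_self_sqrt Real.pi_pos.le]]
    field_simp
  have hgen : ∀ m : ℕ, m ∈ Finset.Ico 1 6 →
      Real.Gamma ((m : ℝ) / ((6:ℕ):ℝ)) ^ n m = (c m * Real.Gamma ((1:ℝ)/3) ^ a m * Real.sqrt Real.pi ^ b m) ^ n m := by
    intro m hm
    congr 1
    have hm' : m = 1 ∨ m = 2 ∨ m = 3 ∨ m = 4 ∨ m = 5 := by
      have := Finset.mem_Ico.mp hm; omega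
    rcases hm' with rfl | rfl | rfl | rfl | rfl
    · simp (decide := true) only [c, a, b, if_true, Nat.cast_one, Nat.cast_ofNat]
      exact g1
    · simp (decide := true) only [c, a, b, Nat.cast_ofNat, if_true, if_false,
        show ((2:ℝ) / 6) = 1 / 3 from by norm_num, zpow_one, zpow_zero, one_mul, mul_one]
    · simp (decide := true) only [c, a, b, Nat.cast_ofNat, if_true, if_false,
        show ((3:ℝ) / 6) = 1 / 2 from by norm_num, Real.Gamma_one_half_eq, zpow_one, zpow_zero, one_mul, mul_one]
    · simp (decide := true) only [c, a, b, Nat.cast_ofNat, if_true, if_false,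
        show ((4:ℝ) / 6) = 2 / 3 from by norm_num]
      rw [Gamma_two_thirds, ← hss, zpow_neg, zpow_one]
      field_simp
    · simp (decide := true) only [c, a, b, Nat.cast_ofNat, if_true, if_false]
      exact g5
  rw [Finset.prod_congr rfl hgen, prod_mul_zpow_zpow _ c a b n hG hsπ] at halg
  -- the constant C = Π c m ^ n m is algebraic and ≠ 0
  have htalg : IsAlgebraic ℚ t := by
    rw [ht]
    exact ((isAlgebraic_two_rpow_two_thirds.mul (isAlgebraic_sqrt_nat 3)).mul
      ((by simpa using isAlgebraic_nat (R := ℚ) (A := ℝ) 2 : IsAlgebraic ℚ (2:ℝ))).inv)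
  have h2alg : IsAlgebraic ℚ (2:ℝ) := by simpa using isAlgebraic_nat (R := ℚ) (A := ℝ) 2
  have hC : IsAlgebraic ℚ (∏ m ∈ Finset.Ico 1 6, c m ^ n m) := by
    rw [prod_Ico_one_six]
    simp (decide := true) only [c, if_true, if_false, one_zpow, mul_one]
    exact ((isAlgebraic_zpow htalg _).mul (isAlgebraic_zpow (h2alg.mul (isAlgebraic_sqrt_nat 3).inv) _)).mul
      (isAlgebraic_zpow (h2alg.mul htalg.inv) _)
  have hC0 : (∏ m ∈ Finset.Ico 1 6, c m ^ n m) ≠ 0 := by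
    refine Finset.prod_ne_zero_iff.mpr fun m hm => zpow_ne_zero _ ?_
    simp only [c]
    split_ifs <;> positivity
  have hX : IsAlgebraic ℚ (Real.Gamma ((1:ℝ)/3) ^ (∑ m ∈ Finset.Ico 1 6, a m * n m)
      * Real.sqrt Real.pi ^ (∑ m ∈ Finset.Ico 1 6, b m * n m)) := by
    have h2 := hC.inv.mul halg
    rwa [← mul_assoc, ← mul_assoc, inv_mul_cancel₀ hC0, one_mul] at h2
  have hz := exps_zero_of_indep hG h hX
  rw [sum_Ico_one_six_int, sum_Ico_one_six_int] at hz
  simp (decide := true) only [a, b, if_true, if_false] at hz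
  have hz' : 2 * n 1 + n 2 - n 4 - 2 * n 5 = 0 ∧ -(n 1) + n 3 + 2 * n 4 + 3 * n 5 = 0 := by omega
  -- type ≡ 0
  intro w hw
  have hf : ∀ i : ℕ, Int.fract ((w : ℚ) * (i : ℚ) / ((6 : ℕ) : ℚ)) =
      (((w * i) % 6 : ℕ) : ℚ) / ((6 : ℕ) : ℚ) := by
    intro i
    rw [show (w : ℚ) * (i : ℚ) / ((6 : ℕ) : ℚ) = ((w * i : ℕ) : ℚ) / ((6 : ℕ) : ℚ) by push_cast; ring]
    exact Int.fract_div_natCast_eq_div_natCast_mod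
  rw [sum_Ico_one_six, hf 1, hf 2, hf 3, hf 4, hf 5]
  have q1 : ((2 * n 1 + n 2 - n 4 - 2 * n 5 : ℤ) : ℚ) = 0 := by rw [hz'.1]; simp
  have q2 : ((-(n 1) + n 3 + 2 * n 4 + 3 * n 5 : ℤ) : ℚ) = 0 := by rw [hz'.2]; simp
  push_cast at q1 q2
  have hw' : w % 6 = 1 ∨ w % 6 = 5 := by
    have h2 : ¬ 2 ∣ w := fun hd => absurd (Nat.Coprime.coprime_dvd_left hd hw) (by decide)
    have h3' : ¬ 3 ∣ w := fun hd => absurd (Nat.Coprime.coprime_dvd_left hd hw) (by decide)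
    omega
  rcases hw' with h1 | h5
  · have a1 : (w * 1) % 6 = 1 := by omega
    have a2 : (w * 2) % 6 = 2 := by omega
    have a3 : (w * 3) % 6 = 3 := by omega
    have a4 : (w * 4) % 6 = 4 := by omega
    have a5 : (w * 5) % 6 = 5 := by omega
    rw [a1, a2, a3, a4, a5]; push_cast
    linear_combination (2 * q1 + 3 * q2) / 6
  · have a1 : (w * 1) % 6 = 5 := by omega
    have a2 : (w * 2) % 6 = 4 := by omega
    have a3 : (w * 3) % 6 = 3 := by omega
    have a4 : (w * 4) % 6 = 2 := by omega
    have a5 : (w * 5) % 6 = 1 := by omega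
    rw [a1, a2, a3, a4, a5]; push_cast
    linear_combination (4 * q1 + 3 * q2) / 6

end ChudnovskyLevels
end Summit.KontsevichZagierPeriods.FermatIsogeny.DeepTargets
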